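import Summits.QuantumFields.BalabanUV.Beta.MultiscaleAveragingPointwise

/-!
# `Summit.QuantumFields.BalabanUV.Beta.CovariantKato` — engine file 12: KATO's sub-mean-value inequality for the covariant lattice
# Laplacian `D*D = covDT ∘ covD` with ARBITRARY isometric bond matrices: the fibre norm `‖f(x)‖` is a sub-solution of the FREE
# weighted graph Laplacian up to the source — `W(x)·‖f(x)‖ ≤ ‖(D*Df)(x)‖ + Σ_{b ∋ x} c_b²·‖f(other end of b)‖`, `W(x) = Σ_{b ∋ x} c_b²`
# (item (K) of the owner's decomposition E-an4-141a of O.2 item (ii-b) for the MODEL; generic bond structure)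

HONEST FRAMING (page 1 of everything in this cell).  Discharging `FlowStep.BetaPertH` would make Bałaban's ultraviolet
stability UNCONDITIONAL — a constructive-QFT result; it is NOT the continuum limit and NOT the Clay problem.  This module
discharges nothing of `BetaPertH`; it is [folklore] finite-dimensional algebra, kernel-checked, by the OWNER of binder row D4 (unit
`b2b-balaban-beta-an4`, gen 44).  HONEST DEPENDENCY: continuum YM on T⁴ ⇐ BetaPertH ∧ nine spine estimates (0/9 proved); BetaPertH ⇐
(D1) ∧ (D4) ∧ CAP+tail; G-an2-4 gates asym, D1 and NE2/3/4.

THE POINT.  The local-regularity datum `hreg` of file 9b (`MultiscaleSupMember`) — O.2 item (ii-b) for the multi-region MODEL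
operator — decomposes (GAPS E-an4-141a) into (P) the pointwise averaging budget (file 10a, KERNEL), (K) Kato's inequality for the
covariant part, (DS) the free Dirichlet solve on lattice balls, and (MV) the mean-value inequality for nonnegative free sub-harmonic
functions (the one XL item).  THIS FILE is (K), for EVERY column-orthonormal `Rm` (no smallness of the «field» — this is where «any
U» costs nothing): on any finite bond structure `src, tgt : Bd → St` with bond weights `c` and bond matrices `Rm` with
`Σ_k R_{ki}R_{kj} = δ_{ij}`, for every field `f : St × Cp → ℝ` and site `x`,

  `W(x)·‖f(x,·)‖ ≤ ‖(D*D f)(x,·)‖ + Σ_{b : tgt b = x} c_b²·‖f(src b,·)‖ + Σ_{b : src b = x} c_b²·‖f(tgt b,·)‖`,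
  `W(x) = Σ_{b : tgt b = x} c_b² + Σ_{b : src b = x} c_b²`, `‖v‖ = √(Σ_i v_i²)` the fibre norm.

WHAT IS CERTIFIED (kernel, 0 sorry):
* §1 fibre-norm bookkeeping: `sqrt_sum_sq_add_le` (Minkowski for two vectors), `sqrt_sum_sq_sum_le` (for a finite sum of vectors),
  `sqrt_sum_sq_smul` (`‖a·v‖ = |a|·‖v‖`), `col_orth_apply` (`Σ_k R_{ki}(Rg)_k = g_i`), `row_orth_of_col_orth` (`RᵀR = 1 ⟹ RRᵀ = 1`
  for square matrices, via `mul_eq_one_comm`), `sqrt_sum_sq_Rm` ∕ `sqrt_sum_sq_RmT` (`‖Rv‖ = ‖v‖ = ‖Rᵀv‖`, from file 10a's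
  `isometry_sq_sum`);
* §2 **`covLap_apply_split`** — the pointwise form of `covDT ∘ covD` (the tree's `covDT_apply`∕`covD_apply` with `RᵀR = 1`):
  `(D*Df)(x,i) = W(x)·f(x,i) − Σ_{b : tgt b = x} c_b²·(R_bᵀ f(src b))_i − Σ_{b : src b = x} c_b²·(R_b f(tgt b))_i`;
* §3 **`kato_covLap`** — the inequality above.
Nothing of the torus, the cells or the averaging part is used; a consumer combines it with file 10a's budget for `levelOp = D*D +
Σ_l a_lG_lᵀG_l` (`B9Thm37GlueTorusCovLevels.levelOp` = `covDT ∘ covD + levelSum`).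

LOCATORS (shape only, nothing printed asserted; ABSOLUTE RULE): [Balaban1985BackgroundPropagators] (3.3) pp. 390–391, (3.8) p. 392,
(3.23) p. 394 (the covariant derivative, its adjoint, `Δ^η_U = D^η*_U D^η_U`).  Row D4: NO class change (critical-path width 0; (K) is
one elementary piece of the open node (ii-b); D4 DISCHARGE NO DATE); NOT BetaPertH, NOT continuum, NOT Clay, NOT summit progress.
-/

open scoped BigOperators
open Finset

namespace Summit.QuantumFields.BalabanUV.Beta.CovariantKato

open Summit.QuantumFields.BalabanUV.Beta.MultiscaleAveragingPointwise (isometry_sq_sum)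
open Literature.MathematicalPhysics.QuantumFieldTheory.Balaban1983to89
open Literature.MathematicalPhysics.QuantumFieldTheory.Balaban1983to89.B9Thm37Glue (covD covDT covD_apply covDT_apply)

noncomputable section

/-! ## §1 Fibre-norm bookkeeping -/

section Fibre

variable {Cp : Type} [Fintype Cp]

/-- Minkowski for two vectors: `√(Σ(a+b)²) ≤ √(Σa²) + √(Σb²)`. [folklore] -/
theorem sqrt_sum_sq_add_le (a b : Cp → ℝ) :
    Real.sqrt (∑ i, (a i + b i) ^ 2) ≤ Real.sqrt (∑ i, a i ^ 2) + Real.sqrt (∑ i, b i ^ 2) := by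
  have hA0 : 0 ≤ ∑ i, a i ^ 2 := Finset.sum_nonneg fun i _ => sq_nonneg (a i)
  have hB0 : 0 ≤ ∑ i, b i ^ 2 := Finset.sum_nonneg fun i _ => sq_nonneg (b i)
  have hcs : (∑ i, a i * b i) ^ 2 ≤ (∑ i, a i ^ 2) * ∑ i, b i ^ 2 := Finset.sum_mul_sq_le_sq_mul_sq univ a b
  have hP : ∑ i, a i * b i ≤ Real.sqrt (∑ i, a i ^ 2) * Real.sqrt (∑ i, b i ^ 2) := by
    rw [← Real.sqrt_mul hA0]
    calc ∑ i, a i * b i ≤ |∑ i, a i * b i| := le_abs_self _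
      _ = Real.sqrt ((∑ i, a i * b i) ^ 2) := (Real.sqrt_sq_eq_abs _).symm
      _ ≤ Real.sqrt ((∑ i, a i ^ 2) * ∑ i, b i ^ 2) := Real.sqrt_le_sqrt hcs
  have hexp : ∑ i, (a i + b i) ^ 2 = ∑ i, a i ^ 2 + 2 * ∑ i, a i * b i + ∑ i, b i ^ 2 := by
    have h : ∀ i, (a i + b i) ^ 2 = a i ^ 2 + 2 * (a i * b i) + b i ^ 2 := fun i => by ring
    simp only [h, Finset.sum_add_distrib, ← Finset.mul_sum]
  have hR0 : 0 ≤ Real.sqrt (∑ i, a i ^ 2) + Real.sqrt (∑ i, b i ^ 2) :=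
    add_nonneg (Real.sqrt_nonneg _) (Real.sqrt_nonneg _)
  have hle : ∑ i, (a i + b i) ^ 2 ≤ (Real.sqrt (∑ i, a i ^ 2) + Real.sqrt (∑ i, b i ^ 2)) ^ 2 := by
    rw [hexp, add_sq, Real.sq_sqrt hA0, Real.sq_sqrt hB0]
    linarith [hP]
  calc Real.sqrt (∑ i, (a i + b i) ^ 2) ≤ Real.sqrt ((Real.sqrt (∑ i, a i ^ 2) + Real.sqrt (∑ i, b i ^ 2)) ^ 2) :=
        Real.sqrt_le_sqrt hle
    _ = Real.sqrt (∑ i, a i ^ 2) + Real.sqrt (∑ i, b i ^ 2) := Real.sqrt_sq hR0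

/-- Minkowski for a finite family of vectors: `√(Σ_i(Σ_{b∈F} v_b i)²) ≤ Σ_{b∈F} √(Σ_i (v_b i)²)`. [folklore] -/
theorem sqrt_sum_sq_sum_le {β : Type} [DecidableEq β] (F : Finset β) (v : β → Cp → ℝ) :
    Real.sqrt (∑ i, (∑ b ∈ F, v b i) ^ 2) ≤ ∑ b ∈ F, Real.sqrt (∑ i, v b i ^ 2) := by
  induction F using Finset.induction_on with
  | empty => simp
  | insert b F hb ih =>
      rw [Finset.sum_insert hb]
      have h1 : (∑ i, (∑ b' ∈ insert b F, v b' i) ^ 2) = ∑ i, (v b i + ∑ b' ∈ F, v b' i) ^ 2 := by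
        refine Finset.sum_congr rfl fun i _ => ?_
        rw [Finset.sum_insert hb]
      rw [h1]
      exact (sqrt_sum_sq_add_le _ _).trans (add_le_add le_rfl ih)

/-- Scalars pull out of the fibre norm: `√(Σ(a·v_i)²) = |a|·√(Σv_i²)`. [folklore] -/
theorem sqrt_sum_sq_smul (a : ℝ) (v : Cp → ℝ) :
    Real.sqrt (∑ i, (a * v i) ^ 2) = |a| * Real.sqrt (∑ i, v i ^ 2) := by
  have h : ∑ i, (a * v i) ^ 2 = a ^ 2 * ∑ i, v i ^ 2 := by
    rw [Finset.mul_sum]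
    exact Finset.sum_congr rfl fun i _ => by ring
  rw [h, Real.sqrt_mul (sq_nonneg a), Real.sqrt_sq_eq_abs]

variable [DecidableEq Cp]

/-- Column-orthonormality in action: `Σ_k R_{ki}·(Σ_j R_{kj} g_j) = g_i`. [folklore] -/
theorem col_orth_apply (Rm : Cp → Cp → ℝ) (hRm : ∀ i j, ∑ k, Rm k i * Rm k j = if i = j then (1 : ℝ) else 0)
    (g : Cp → ℝ) (i : Cp) : ∑ k, Rm k i * ∑ j, Rm k j * g j = g i := by
  calc ∑ k, Rm k i * ∑ j, Rm k j * g j = ∑ k, ∑ j, Rm k i * Rm k j * g j := by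
        refine Finset.sum_congr rfl fun k _ => ?_
        rw [Finset.mul_sum]
        exact Finset.sum_congr rfl fun j _ => by ring
    _ = ∑ j, (∑ k, Rm k i * Rm k j) * g j := by
        rw [Finset.sum_comm]
        exact Finset.sum_congr rfl fun j _ => by rw [Finset.sum_mul]
    _ = g i := by
        simp_rw [hRm]
        simp [ite_mul, Finset.sum_ite_eq]

/-- A square matrix with orthonormal columns has orthonormal rows (`RᵀR = 1 ⟹ RRᵀ = 1`, `mul_eq_one_comm`). [folklore] -/
theorem row_orth_of_col_orth (Rm : Cp → Cp → ℝ) (hRm : ∀ i j, ∑ k, Rm k i * Rm k j = if i = j then (1 : ℝ) else 0)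
    (k k' : Cp) : ∑ i, Rm k i * Rm k' i = if k = k' then (1 : ℝ) else 0 := by
  let M : Matrix Cp Cp ℝ := Matrix.of fun a b => Rm a b
  have h1 : M.transpose * M = 1 := by
    ext i j
    rw [Matrix.mul_apply, Matrix.one_apply]
    simpa [M, Matrix.transpose_apply, Matrix.of_apply] using hRm i j
  have h2 : M * M.transpose = 1 := mul_eq_one_comm.mp h1
  have h3 := congrFun (congrFun h2 k) k'
  rw [Matrix.mul_apply, Matrix.one_apply] at h3
  simpa [M, Matrix.transpose_apply, Matrix.of_apply] using h3

/-- `‖Rv‖ = ‖v‖` (row action). [folklore] -/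
theorem sqrt_sum_sq_Rm (Rm : Cp → Cp → ℝ) (hRm : ∀ i j, ∑ k, Rm k i * Rm k j = if i = j then (1 : ℝ) else 0)
    (v : Cp → ℝ) : Real.sqrt (∑ k, (∑ j, Rm k j * v j) ^ 2) = Real.sqrt (∑ j, v j ^ 2) := by
  rw [isometry_sq_sum Rm hRm v]

/-- `‖Rᵀv‖ = ‖v‖` (transpose action), from column-orthonormality alone. [folklore] -/
theorem sqrt_sum_sq_RmT (Rm : Cp → Cp → ℝ) (hRm : ∀ i j, ∑ k, Rm k i * Rm k j = if i = j then (1 : ℝ) else 0)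
    (v : Cp → ℝ) : Real.sqrt (∑ i, (∑ k, Rm k i * v k) ^ 2) = Real.sqrt (∑ k, v k ^ 2) := by
  rw [isometry_sq_sum (fun i k => Rm k i) (fun k k' => row_orth_of_col_orth Rm hRm k k') v]

end Fibre

/-! ## §2 The pointwise form of `covDT ∘ covD` -/

section Lap

variable {St Bd Cp : Type} [Fintype Bd] [Fintype Cp] [DecidableEq St] [DecidableEq Cp]
  (src tgt : Bd → St) (c : Bd → ℝ) (Rm : Bd → Cp → Cp → ℝ)

/-- **`(D*Df)(x,i) = W(x)·f(x,i) − Σ_{b : tgt b = x} c_b²·(R_bᵀ f(src b))_i − Σ_{b : src b = x} c_b²·(R_b f(tgt b))_i`**, with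
`W(x) = Σ_{b : tgt b = x} c_b² + Σ_{b : src b = x} c_b²` — the covariant graph Laplacian read off `covDT_apply`∕`covD_apply` with
`RᵀR = 1`. [cite: Balaban1985BackgroundPropagators, (3.23) p.394 + (3.3) pp.390-391 + (3.8) p.392] [folklore] -/
theorem covLap_apply_split (hRm : ∀ b i j, ∑ k, Rm b k i * Rm b k j = if i = j then (1 : ℝ) else 0)
    (f : St × Cp → ℝ) (x : St) (i : Cp) :
    covDT src tgt c Rm (covD src tgt c Rm f) (x, i) =
      ((∑ b ∈ univ.filter (fun b => tgt b = x), c b ^ 2) + ∑ b ∈ univ.filter (fun b => src b = x), c b ^ 2) * f (x, i)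
        - ∑ b ∈ univ.filter (fun b => tgt b = x), c b ^ 2 * ∑ k, Rm b k i * f (src b, k)
        - ∑ b ∈ univ.filter (fun b => src b = x), c b ^ 2 * ∑ j, Rm b i j * f (tgt b, j) := by
  rw [covDT_apply, Finset.sum_sub_distrib]
  -- the target bonds
  have hT : ∑ b, (if tgt b = (x, i).1 then c b else 0) * ∑ k, Rm b k (x, i).2 * covD src tgt c Rm f (b, k) =
      ∑ b ∈ univ.filter (fun b => tgt b = x), (c b ^ 2 * f (x, i) - c b ^ 2 * ∑ k, Rm b k i * f (src b, k)) := by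
    rw [Finset.sum_filter]
    refine Finset.sum_congr rfl fun b _ => ?_
    by_cases hb : tgt b = x
    · simp only [hb, if_true, covD_apply]
      have h1 : ∑ k, Rm b k i * (c b * (∑ j, Rm b k j * f (x, j) - f (src b, k))) =
          c b * (∑ k, Rm b k i * ∑ j, Rm b k j * f (x, j)) - c b * ∑ k, Rm b k i * f (src b, k) := by
        rw [Finset.mul_sum, Finset.mul_sum, ← Finset.sum_sub_distrib]
        exact Finset.sum_congr rfl fun k _ => by ring
      rw [h1, col_orth_apply (Rm b) (hRm b) (fun j => f (x, j)) i]
      ring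
    · simp only [hb, if_false, zero_mul]
  -- the source bonds
  have hS : ∑ b, (if src b = (x, i).1 then c b else 0) * covD src tgt c Rm f (b, (x, i).2) =
      ∑ b ∈ univ.filter (fun b => src b = x), (c b ^ 2 * ∑ j, Rm b i j * f (tgt b, j) - c b ^ 2 * f (x, i)) := by
    rw [Finset.sum_filter]
    refine Finset.sum_congr rfl fun b _ => ?_
    by_cases hb : src b = x
    · simp only [hb, if_true, covD_apply]
      ring
    · simp only [hb, if_false, zero_mul]
  rw [hT, hS, Finset.sum_sub_distrib, Finset.sum_sub_distrib, ← Finset.sum_mul, ← Finset.sum_mul]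
  ring

/-! ## §3 Kato's inequality -/

/-- **KATO'S SUB-MEAN-VALUE INEQUALITY for the covariant lattice Laplacian with ARBITRARY column-orthonormal bond matrices.**
For every field `f` and site `x`:
`(Σ_{b : tgt b = x} c_b² + Σ_{b : src b = x} c_b²)·√(Σ_i f(x,i)²) ≤ √(Σ_i ((D*Df)(x,i))²) + Σ_{b : tgt b = x} c_b²·√(Σ_k f(src b,k)²) +
Σ_{b : src b = x} c_b²·√(Σ_j f(tgt b,j)²)` — the fibre norm of `f` is a sub-solution of the FREE weighted graph Laplacian up to the
source `‖D*Df‖`; the transports drop out because `‖R_bv‖ = ‖v‖ = ‖R_bᵀv‖`.  Item (K) of E-an4-141a.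
[cite: Balaban1985BackgroundPropagators, (3.23) p.394] [folklore] -/
theorem kato_covLap (hRm : ∀ b i j, ∑ k, Rm b k i * Rm b k j = if i = j then (1 : ℝ) else 0)
    (f : St × Cp → ℝ) (x : St) :
    ((∑ b ∈ univ.filter (fun b => tgt b = x), c b ^ 2) + ∑ b ∈ univ.filter (fun b => src b = x), c b ^ 2) *
        Real.sqrt (∑ i, f (x, i) ^ 2) ≤
      Real.sqrt (∑ i, (covDT src tgt c Rm (covD src tgt c Rm f) (x, i)) ^ 2) +
        ∑ b ∈ univ.filter (fun b => tgt b = x), c b ^ 2 * Real.sqrt (∑ k, f (src b, k) ^ 2) +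
        ∑ b ∈ univ.filter (fun b => src b = x), c b ^ 2 * Real.sqrt (∑ j, f (tgt b, j) ^ 2) := by
  classical
  have hsplit := fun i => covLap_apply_split src tgt c Rm hRm f x i
  have hW0 : 0 ≤ (∑ b ∈ univ.filter (fun b => tgt b = x), c b ^ 2) + ∑ b ∈ univ.filter (fun b => src b = x), c b ^ 2 :=
    add_nonneg (Finset.sum_nonneg fun b _ => sq_nonneg (c b)) (Finset.sum_nonneg fun b _ => sq_nonneg (c b))
  -- `W·f(x,·) = (D*Df)(x,·) + vT + vS`, componentwise
  have hsum : ∑ i, ((covDT src tgt c Rm (covD src tgt c Rm f) (x, i) +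
        ∑ b ∈ univ.filter (fun b => tgt b = x), c b ^ 2 * ∑ k, Rm b k i * f (src b, k)) +
        ∑ b ∈ univ.filter (fun b => src b = x), c b ^ 2 * ∑ j, Rm b i j * f (tgt b, j)) ^ 2 =
      ∑ i, ((((∑ b ∈ univ.filter (fun b => tgt b = x), c b ^ 2) + ∑ b ∈ univ.filter (fun b => src b = x), c b ^ 2)) *
        f (x, i)) ^ 2 := by
    refine Finset.sum_congr rfl fun i _ => ?_
    have h := hsplit i
    congr 1
    linarith
  -- the two transported pieces
  have hT_le : Real.sqrt (∑ i, (∑ b ∈ univ.filter (fun b => tgt b = x), c b ^ 2 * ∑ k, Rm b k i * f (src b, k)) ^ 2) ≤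
      ∑ b ∈ univ.filter (fun b => tgt b = x), c b ^ 2 * Real.sqrt (∑ k, f (src b, k) ^ 2) := by
    have h1 := sqrt_sum_sq_sum_le (univ.filter fun b => tgt b = x) (fun b i => c b ^ 2 * ∑ k, Rm b k i * f (src b, k))
    beta_reduce at h1
    refine h1.trans (le_of_eq ?_)
    refine Finset.sum_congr rfl fun b _ => ?_
    simp only [sqrt_sum_sq_smul, abs_of_nonneg (sq_nonneg (c b)), sqrt_sum_sq_RmT (Rm b) (hRm b)]
  have hS_le : Real.sqrt (∑ i, (∑ b ∈ univ.filter (fun b => src b = x), c b ^ 2 * ∑ j, Rm b i j * f (tgt b, j)) ^ 2) ≤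
      ∑ b ∈ univ.filter (fun b => src b = x), c b ^ 2 * Real.sqrt (∑ j, f (tgt b, j) ^ 2) := by
    have h1 := sqrt_sum_sq_sum_le (univ.filter fun b => src b = x) (fun b i => c b ^ 2 * ∑ j, Rm b i j * f (tgt b, j))
    beta_reduce at h1
    refine h1.trans (le_of_eq ?_)
    refine Finset.sum_congr rfl fun b _ => ?_
    simp only [sqrt_sum_sq_smul, abs_of_nonneg (sq_nonneg (c b)), sqrt_sum_sq_Rm (Rm b) (hRm b)]
  -- the left-hand side as a fibre norm, then Minkowski twice
  rw [← abs_of_nonneg hW0, ← sqrt_sum_sq_smul, ← hsum]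
  calc Real.sqrt (∑ i, ((covDT src tgt c Rm (covD src tgt c Rm f) (x, i) +
          ∑ b ∈ univ.filter (fun b => tgt b = x), c b ^ 2 * ∑ k, Rm b k i * f (src b, k)) +
          ∑ b ∈ univ.filter (fun b => src b = x), c b ^ 2 * ∑ j, Rm b i j * f (tgt b, j)) ^ 2)
      ≤ Real.sqrt (∑ i, (covDT src tgt c Rm (covD src tgt c Rm f) (x, i) +
            ∑ b ∈ univ.filter (fun b => tgt b = x), c b ^ 2 * ∑ k, Rm b k i * f (src b, k)) ^ 2) +
          Real.sqrt (∑ i, (∑ b ∈ univ.filter (fun b => src b = x), c b ^ 2 * ∑ j, Rm b i j * f (tgt b, j)) ^ 2) :=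
        sqrt_sum_sq_add_le (fun i => covDT src tgt c Rm (covD src tgt c Rm f) (x, i) +
            ∑ b ∈ univ.filter (fun b => tgt b = x), c b ^ 2 * ∑ k, Rm b k i * f (src b, k))
          (fun i => ∑ b ∈ univ.filter (fun b => src b = x), c b ^ 2 * ∑ j, Rm b i j * f (tgt b, j))
    _ ≤ (Real.sqrt (∑ i, (covDT src tgt c Rm (covD src tgt c Rm f) (x, i)) ^ 2) +
          Real.sqrt (∑ i, (∑ b ∈ univ.filter (fun b => tgt b = x), c b ^ 2 * ∑ k, Rm b k i * f (src b, k)) ^ 2)) +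
          Real.sqrt (∑ i, (∑ b ∈ univ.filter (fun b => src b = x), c b ^ 2 * ∑ j, Rm b i j * f (tgt b, j)) ^ 2) :=
        add_le_add (sqrt_sum_sq_add_le (fun i => covDT src tgt c Rm (covD src tgt c Rm f) (x, i))
          (fun i => ∑ b ∈ univ.filter (fun b => tgt b = x), c b ^ 2 * ∑ k, Rm b k i * f (src b, k))) le_rfl
    _ ≤ _ := add_le_add (add_le_add le_rfl hT_le) hS_le

end Lap

end

end Summit.QuantumFields.BalabanUV.Beta.CovariantKato
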